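import Literature.NumberTheory.EllipticCurves.IwasawaAlgebraEisensteinQuotientDVRProofs
import Literature.NumberTheory.EllipticCurves.IwasawaAlgebraSpecializationCountProofs
import HarnessLib

/-!
# Indices of submodules of a FREE RANK-ONE module over Howard's Eisenstein quotient `S_m = Λ/(T^m + p)`:
# a submodule containing an element NOT divisible by `π^j = T^j` has index `≤ p^j` (proofs file)

Topic `NumberTheory/EllipticCurves`. THEOREMS ONLY (no definition, no named fact, no instance, no `sorry`), in
the vocabulary of the tree (`IwasawaAlgebra p = Λ = ℤ_p⟦T⟧`; the quotient ring is written
`IwasawaAlgebra p ⧸ Ideal.span {X^m + C p}`; modules carry a `Λ`- and an `S_m`-structure with `IsScalarTower`, as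
the honest module `H` of `Summits/…/PrintX9MuPartSpecWitnessOfDVRConclusion`).

WHAT. Let `m ≥ 1`, `S_m = Λ/(q_m)` (a DVR with uniformiser `π = T mod q_m`, `IwasawaAlgebraEisensteinQuotientDVRProofs`),
and let `H` be an `S_m`-module which is FREE OF RANK ONE: `r ↦ r • x₀` is a bijection `S_m → H` (Howard's Theorem
1.6.1 (a) [Howard 2004, Thm. 1.6.1 / 2.2.10 (a): "`H¹_𝓕(K, T)` is a free rank-one `R`-module"] for the specialised
Selmer module `H_m = H¹_{F_𝔮}(K, T_𝔮)`, `𝔮 = q_m`). Then for every `Λ`-submodule `N ≤ H` and every `j < m`: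
* `IwasawaAlgebra.span_X_pow_smul_top_le_of_not_mem` — if `N` contains an element `y ∉ T^j • H`, then
  `T^j • H ≤ N` (DVR: `y = r • x₀` with `v_π(r) < j`, so `π^j ∈ (r)`);
* `IwasawaAlgebra.natCard_quotient_span_X_pow_smul_top` — `#(H ⧸ T^j • H) = #(Λ/(q_m, T^j)) = p^j`
  (`nat_card_quotient_span_X_pow_sup_span_eq`, transported along `H ≃ S_m`);
* **`IwasawaAlgebra.finite_quotient_and_natCard_le_of_not_mem_X_pow_smul`** — hence `H ⧸ N` is finite and
  **`#(H ⧸ N) ≤ p^j`**; module-range form `…_range_…` for `N = LinearMap.range f`.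

WHY (use; cell `pub/bsd-print-x9`, S1 = STUB 3 of the shared μ-item, COMPACT side). In the composition
`HeegnerMuPartStabilized.nonempty_specWitness_of_dvrConclusion` (p643969) the fields `SpecWitness.finite_coker` /
`card_coker_le` — an `m`-UNIFORM bound on the cokernel of Howard's control map `f_m : 𝔖 → H_m` [Howard 2004,
Prop. 3.2.8 = journal Prop. 2.2.8; Mazur–Rubin 2004, Prop. 5.3.14] — are INPUTS next to `hfree` (Thm. 1.6.1 (a)). This
file reduces them to ONE divisibility statement: it suffices that `range f_m` contain an element `f_m(e)` with
`f_m(e) ∉ T^{j₀} • H_m` for a `j₀` independent of `m` — which holds for `e ∈ 𝔖 ∖ p𝔖` and `j₀ = p^{n₁}` with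
`e_{n₁,1} ≠ 0 ∈ H¹(K_{n₁}, E[p])`, by reduction of `H_m` to the `m`-independent module
`H¹(K, E[p] ⊗ Λ/(p, T^{j₀})(ψ))` and Shapiro (`ZpExtension.coresShapiro_bijective`); see the seat memo
`HOME/x10b-p1-w2/S1-COKERNEL-BLUEPRINT-x10b-p1-w2-g8.md`. No Poitou–Tate duality and no local index enters the
compact side this way. Pure commutative algebra; nothing about Galois cohomology is asserted here. BSD is not proved
by any of this.

References: [Howard2004HeegnerKolyvagin] B. Howard, *The Heegner point Kolyvagin system*, Compositio Math. 140 (2004),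
Thm. 1.6.1 (a), §2.2 (`S_𝔮` a DVR), Prop. 2.2.8, proof of Thm. 2.2.10 ("taking `𝔮 = T^m + p`") = arXiv:1202.6340
Thm. 1.6.1, Prop. 3.2.8, Thm. 3.2.10; [MazurRubinMemoirs2004] Prop. 5.3.14; [Washington1997] §7.1, §13.2
(Lemma 13.7, Prop. 13.8); [SerreLocalFields1979] I §6.
-/

set_option autoImplicit false

noncomputable section

open scoped Classical Pointwise

universe u

namespace Literature.NumberTheory.EllipticCurves.IwasawaAlgebra

variable (p : ℕ) [hp : Fact p.Prime]

/-! ## §1 Scalar bookkeeping: `T^j ∈ Λ` acts on an `S_m`-module through `π^j`, `π = T mod q_m` -/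

section Bookkeeping

variable {m : ℕ}
  {H : Type u} [AddCommGroup H] [Module (IwasawaAlgebra p) H]
  [Module (IwasawaAlgebra p ⧸
    Ideal.span {(PowerSeries.X ^ m + PowerSeries.C (p : ℤ_[p]) : IwasawaAlgebra p)}) H]
  [IsScalarTower (IwasawaAlgebra p) (IwasawaAlgebra p ⧸
    Ideal.span {(PowerSeries.X ^ m + PowerSeries.C (p : ℤ_[p]) : IwasawaAlgebra p)}) H]

/-- On an `S_m`-module with compatible `Λ`-structure, `g ∈ Λ` acts as its class `g mod q_m ∈ S_m`.
[cite: Howard2004HeegnerKolyvagin, §2.2 (H¹(K, T_𝔮) is an S_𝔮-module)] -/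
theorem smul_eq_mk_smul (g : IwasawaAlgebra p) (h : H) :
    g • h = (Ideal.Quotient.mk
      (Ideal.span {(PowerSeries.X ^ m + PowerSeries.C (p : ℤ_[p]) : IwasawaAlgebra p)}) g) • h := by
  rw [← Ideal.Quotient.algebraMap_eq, algebraMap_smul]

/-- `T^j • h = π^j • h` with `π = T mod q_m`. [cite: Howard2004HeegnerKolyvagin, §2.2 (π a uniformiser of S_𝔮)] -/
theorem X_pow_smul_eq_mk_X_pow_smul (j : ℕ) (h : H) :
    ((PowerSeries.X : IwasawaAlgebra p) ^ j) • h = ((Ideal.Quotient.mk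
      (Ideal.span {(PowerSeries.X ^ m + PowerSeries.C (p : ℤ_[p]) : IwasawaAlgebra p)}) PowerSeries.X) ^ j) • h := by
  rw [smul_eq_mk_smul p (m := m), map_pow]

/-- A `Λ`-submodule of an `S_m`-module with compatible structures is stable under the `S_m`-action.
[cite: Howard2004HeegnerKolyvagin, §2.2 (H¹(K, T_𝔮) is an S_𝔮-module)] -/
theorem mk_smul_mem_of_mem (N : Submodule (IwasawaAlgebra p) H)
    (r : IwasawaAlgebra p ⧸
      Ideal.span {(PowerSeries.X ^ m + PowerSeries.C (p : ℤ_[p]) : IwasawaAlgebra p)})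
    {y : H} (hy : y ∈ N) : r • y ∈ N := by
  obtain ⟨g, rfl⟩ := Ideal.Quotient.mk_surjective r
  rw [← smul_eq_mk_smul p]
  exact N.smul_mem g hy

end Bookkeeping

/-! ## §1b Plain `Λ`-modules: membership in `T^j • H` and its detection by maps killing `T^j • H` -/

section PlainLambda

variable {H : Type u} [AddCommGroup H] [Module (IwasawaAlgebra p) H]

/-- Membership in `T^j • H`: `x ∈ (T^j) • ⊤` iff `x = T^j • h` for some `h`.
[cite: AtiyahMacdonald1969, Ch. 2 (the submodule 𝔞M)] -/
theorem mem_span_X_pow_smul_top_iff (j : ℕ) (x : H) :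
    x ∈ (Ideal.span {(PowerSeries.X : IwasawaAlgebra p) ^ j} • ⊤ : Submodule (IwasawaAlgebra p) H) ↔
      ∃ h : H, ((PowerSeries.X : IwasawaAlgebra p) ^ j) • h = x := by
  rw [Submodule.ideal_span_singleton_smul, Submodule.mem_smul_pointwise_iff_exists]
  constructor
  · rintro ⟨h, -, rfl⟩
    exact ⟨h, rfl⟩
  · rintro ⟨h, rfl⟩
    exact ⟨h, Submodule.mem_top, rfl⟩

/-- **Non-divisibility is detected by any additive map killing `T^j • H`**: if `θ : H → Q` is additive with
`θ (T^j • h) = 0` for all `h` and `θ y ≠ 0`, then `y ∉ T^j • H` — the form in which the hypothesis of the main lemma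
is discharged (`θ` = reduction of `H_m = H¹(K, T_𝔮)` to `H¹(K, T_𝔮/π^j T_𝔮) = H¹(K, E[p] ⊗ Λ/(p, T^j)(ψ))`, an
`m`-independent module). [cite: Howard2004HeegnerKolyvagin, §2.2 (T_𝔮/𝔪^k T_𝔮) and proof of Thm. 2.2.10] -/
theorem not_mem_X_pow_smul_top_of_map_ne_zero {Q : Type*} [AddCommGroup Q] (θ : H →+ Q) {j : ℕ}
    (hθ : ∀ h : H, θ (((PowerSeries.X : IwasawaAlgebra p) ^ j) • h) = 0) {y : H} (hy : θ y ≠ 0) :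
    y ∉ (Ideal.span {(PowerSeries.X : IwasawaAlgebra p) ^ j} • ⊤ : Submodule (IwasawaAlgebra p) H) := by
  intro hmem
  rw [mem_span_X_pow_smul_top_iff p] at hmem
  obtain ⟨h, rfl⟩ := hmem
  exact hy (hθ h)

end PlainLambda

/-! ## §2 Free rank-one `S_m`-modules: a submodule with a non-`π^j`-divisible element has index `≤ p^j` -/

section FreeRankOne

variable {m : ℕ}
  {H : Type u} [AddCommGroup H] [Module (IwasawaAlgebra p) H]
  [Module (IwasawaAlgebra p ⧸
    Ideal.span {(PowerSeries.X ^ m + PowerSeries.C (p : ℤ_[p]) : IwasawaAlgebra p)}) H]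
  [IsScalarTower (IwasawaAlgebra p) (IwasawaAlgebra p ⧸
    Ideal.span {(PowerSeries.X ^ m + PowerSeries.C (p : ℤ_[p]) : IwasawaAlgebra p)}) H]
  (x₀ : H) (hx₀ : Function.Bijective (LinearMap.toSpanSingleton (IwasawaAlgebra p ⧸
    Ideal.span {(PowerSeries.X ^ m + PowerSeries.C (p : ℤ_[p]) : IwasawaAlgebra p)}) H x₀))

include hx₀

/-- **`#(H ⧸ T^j • H) = p^j`** for the free rank-one `S_m`-module `H` and `j < m`
(`H ≃ S_m = Λ/(q_m)` and `#(Λ/(q_m, T^j)) = #(Λ/(p, T^j)) = p^j`).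
[cite: Howard2004HeegnerKolyvagin, proof of Thm. 2.2.10 (𝔮 = T^m + p)] [cite: Washington1997, Prop. 13.8 and §13.2] -/
theorem natCard_quotient_span_X_pow_smul_top {j : ℕ} (hjm : j < m) :
    Nat.card (H ⧸ (Ideal.span {(PowerSeries.X : IwasawaAlgebra p) ^ j} • ⊤ :
      Submodule (IwasawaAlgebra p) H)) = p ^ j := by
  -- `H ≃ₗ[Λ] Λ/(q_m)` by restriction of scalars of `S_m ≃ H`, `r ↦ r • x₀`
  let e : (IwasawaAlgebra p ⧸
      Ideal.span {(PowerSeries.X ^ m + PowerSeries.C (p : ℤ_[p]) : IwasawaAlgebra p)}) ≃ₗ[IwasawaAlgebra p] H :=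
    (LinearEquiv.ofBijective _ hx₀).restrictScalars (IwasawaAlgebra p)
  rw [← Module.card_quotSMulTop_eq_of_linearEquiv _ e, card_quotient_quotSMulTop, sup_comm]
  exact nat_card_quotient_span_X_pow_sup_span_eq p hjm

/-- `H ⧸ T^j • H` is finite (of order `p^j`), `j < m`. [cite: Washington1997, Prop. 13.8] -/
theorem finite_quotient_span_X_pow_smul_top {j : ℕ} (hjm : j < m) :
    Finite (H ⧸ (Ideal.span {(PowerSeries.X : IwasawaAlgebra p) ^ j} • ⊤ :
      Submodule (IwasawaAlgebra p) H)) := by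
  apply Nat.finite_of_card_ne_zero
  rw [natCard_quotient_span_X_pow_smul_top p x₀ hx₀ hjm]
  exact pow_ne_zero _ hp.out.ne_zero

end FreeRankOne

section RankOne

variable {m : ℕ} (hm : 1 ≤ m)
  [IsDomain (IwasawaAlgebra p ⧸
    Ideal.span {(PowerSeries.X ^ m + PowerSeries.C (p : ℤ_[p]) : IwasawaAlgebra p)})]
  [IsDiscreteValuationRing (IwasawaAlgebra p ⧸
    Ideal.span {(PowerSeries.X ^ m + PowerSeries.C (p : ℤ_[p]) : IwasawaAlgebra p)})]
  {H : Type u} [AddCommGroup H] [Module (IwasawaAlgebra p) H]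
  [Module (IwasawaAlgebra p ⧸
    Ideal.span {(PowerSeries.X ^ m + PowerSeries.C (p : ℤ_[p]) : IwasawaAlgebra p)}) H]
  [IsScalarTower (IwasawaAlgebra p) (IwasawaAlgebra p ⧸
    Ideal.span {(PowerSeries.X ^ m + PowerSeries.C (p : ℤ_[p]) : IwasawaAlgebra p)}) H]
  (x₀ : H) (hx₀ : Function.Bijective (LinearMap.toSpanSingleton (IwasawaAlgebra p ⧸
    Ideal.span {(PowerSeries.X ^ m + PowerSeries.C (p : ℤ_[p]) : IwasawaAlgebra p)}) H x₀))

include hm hx₀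

/-- **DVR step.** In the free rank-one `S_m`-module `H = S_m x₀`: if `y ∈ H` is NOT in `T^j • H`, then
`T^j • H ≤ Λ y` — indeed `y = r • x₀` with `r ∉ (π^j)`, so `v_π(r) < j` and `π^j ∈ (r)` (`S_m` a DVR with
uniformiser `π = T mod q_m`). [cite: Howard2004HeegnerKolyvagin, §2.2 (S_𝔮 a discrete valuation ring) and Thm. 1.6.1 (a)]
[cite: SerreLocalFields1979, I §6] -/
theorem span_X_pow_smul_top_le_span_of_not_mem {y : H} {j : ℕ}
    (hy : y ∉ (Ideal.span {(PowerSeries.X : IwasawaAlgebra p) ^ j} • ⊤ : Submodule (IwasawaAlgebra p) H)) :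
    (Ideal.span {(PowerSeries.X : IwasawaAlgebra p) ^ j} • ⊤ : Submodule (IwasawaAlgebra p) H) ≤
      (IwasawaAlgebra p) ∙ y := by
  -- notation
  set π : IwasawaAlgebra p ⧸
      Ideal.span {(PowerSeries.X ^ m + PowerSeries.C (p : ℤ_[p]) : IwasawaAlgebra p)} :=
    Ideal.Quotient.mk _ PowerSeries.X with hπ
  -- `y = r • x₀`
  obtain ⟨r, hr⟩ := hx₀.2 y
  rw [LinearMap.toSpanSingleton_apply] at hr
  -- `r ∉ (π^j)`
  have hr_not : r ∉ Ideal.span {π ^ j} := by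
    intro hmem
    obtain ⟨s, hs⟩ := Ideal.mem_span_singleton'.1 hmem
    apply hy
    rw [mem_span_X_pow_smul_top_iff p]
    refine ⟨s • x₀, ?_⟩
    rw [X_pow_smul_eq_mk_X_pow_smul p (m := m), ← hπ, ← mul_smul, mul_comm, hs, hr]
  have hr0 : r ≠ 0 := by
    rintro rfl
    exact hr_not (zero_mem _)
  -- DVR: `r ~ π^n` with `n < j`, hence `π^j ∈ (r)`
  have hirr : Irreducible π := by
    rw [hπ]
    exact irreducible_mk_X p hm
  obtain ⟨n, u, hu⟩ := IsDiscreteValuationRing.associated_pow_irreducible hr0 hirr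
  -- `hu : r * ↑u = π ^ n`
  have hn : n < j := by
    by_contra hnj
    rw [not_lt] at hnj
    apply hr_not
    rw [Ideal.mem_span_singleton]
    refine ⟨π ^ (n - j) * ↑u⁻¹, ?_⟩
    calc r = π ^ n * ↑u⁻¹ := by rw [← hu, mul_assoc, Units.mul_inv, mul_one]
      _ = π ^ j * (π ^ (n - j) * ↑u⁻¹) := by rw [← mul_assoc, ← pow_add, Nat.add_sub_cancel' hnj]
  have hπj : π ^ j = r * (↑u * π ^ (j - n)) := by
    rw [← mul_assoc, hu, ← pow_add, Nat.add_sub_cancel' hn.le]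
  -- `T^j • h ∈ Λ y` for every `h`
  intro x hx
  rw [mem_span_X_pow_smul_top_iff p] at hx
  obtain ⟨h, rfl⟩ := hx
  obtain ⟨s, hs⟩ := hx₀.2 h
  rw [LinearMap.toSpanSingleton_apply] at hs
  have key : ((PowerSeries.X : IwasawaAlgebra p) ^ j) • h = ((↑u * π ^ (j - n)) * s) • y := by
    rw [X_pow_smul_eq_mk_X_pow_smul p (m := m), ← hπ, ← hs, ← mul_smul, hπj, ← hr, ← mul_smul]
    congr 1
    ring
  rw [key]
  exact mk_smul_mem_of_mem p _ _ (Submodule.mem_span_singleton_self y)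

/-- **`T^j • H ≤ N`** for every `Λ`-submodule `N` of the free rank-one `S_m`-module `H` containing an element
`y ∉ T^j • H`. [cite: Howard2004HeegnerKolyvagin, §2.2 and Thm. 1.6.1 (a)] [cite: SerreLocalFields1979, I §6] -/
theorem span_X_pow_smul_top_le_of_not_mem (N : Submodule (IwasawaAlgebra p) H) {y : H} (hyN : y ∈ N)
    {j : ℕ}
    (hy : y ∉ (Ideal.span {(PowerSeries.X : IwasawaAlgebra p) ^ j} • ⊤ : Submodule (IwasawaAlgebra p) H)) :
    (Ideal.span {(PowerSeries.X : IwasawaAlgebra p) ^ j} • ⊤ : Submodule (IwasawaAlgebra p) H) ≤ N :=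
  (span_X_pow_smul_top_le_span_of_not_mem p hm x₀ hx₀ hy).trans ((Submodule.span_singleton_le_iff_mem _ _).2 hyN)

/-- **Main lemma (index bound in a free rank-one `S_m`-module).** If the `Λ`-submodule `N ≤ H` contains an element
`y ∉ T^j • H` (`j < m`), then `H ⧸ N` is finite and `#(H ⧸ N) ≤ p^j`. This is the shape in which an `m`-UNIFORM
cokernel bound for Howard's control map `𝔖 → H_m = H¹_{F_𝔮}(K, T_𝔮)` (free of rank one by Thm. 1.6.1 (a)) is
obtained from ONE element of `𝔖` whose image is not `π^{j₀}`-divisible, `j₀` independent of `m`.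
[cite: Howard2004HeegnerKolyvagin, Thm. 1.6.1 (a), Prop. 2.2.8 and proof of Thm. 2.2.10 (𝔮 = T^m + p)]
[cite: MazurRubinMemoirs2004, Prop. 5.3.14] -/
theorem finite_quotient_and_natCard_le_of_not_mem_X_pow_smul (N : Submodule (IwasawaAlgebra p) H) {y : H}
    (hyN : y ∈ N) {j : ℕ} (hjm : j < m)
    (hy : y ∉ (Ideal.span {(PowerSeries.X : IwasawaAlgebra p) ^ j} • ⊤ : Submodule (IwasawaAlgebra p) H)) :
    Finite (H ⧸ N) ∧ Nat.card (H ⧸ N) ≤ p ^ j := by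
  have hle := span_X_pow_smul_top_le_of_not_mem p hm x₀ hx₀ N hyN hy
  haveI := finite_quotient_span_X_pow_smul_top p x₀ hx₀ hjm
  -- the surjection `H ⧸ T^j • H → H ⧸ N`
  have hsurj : Function.Surjective (Submodule.factor hle) := Submodule.factor_surjective hle
  refine ⟨Finite.of_surjective _ hsurj, ?_⟩
  rw [← natCard_quotient_span_X_pow_smul_top p x₀ hx₀ hjm]
  exact Nat.card_le_card_of_surjective _ hsurj

/-- **Range form** (the currency of `SpecWitness.finite_coker` / `card_coker_le`): for a `Λ`-linear `f : S → H` into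
the free rank-one `S_m`-module `H` and `e ∈ S` with `f e ∉ T^j • H` (`j < m`), the cokernel `H ⧸ range f` is finite of
order `≤ p^j`. [cite: Howard2004HeegnerKolyvagin, Thm. 1.6.1 (a), Prop. 2.2.8 and proof of Thm. 2.2.10 (𝔮 = T^m + p)]
[cite: MazurRubinMemoirs2004, Prop. 5.3.14] -/
theorem finite_quotient_range_and_natCard_le_of_not_mem_X_pow_smul {S : Type*} [AddCommGroup S]
    [Module (IwasawaAlgebra p) S] (f : S →ₗ[IwasawaAlgebra p] H) (e : S) {j : ℕ} (hjm : j < m)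
    (he : f e ∉ (Ideal.span {(PowerSeries.X : IwasawaAlgebra p) ^ j} • ⊤ : Submodule (IwasawaAlgebra p) H)) :
    Finite (H ⧸ LinearMap.range f) ∧ Nat.card (H ⧸ LinearMap.range f) ≤ p ^ j :=
  finite_quotient_and_natCard_le_of_not_mem_X_pow_smul p hm x₀ hx₀ (LinearMap.range f) (LinearMap.mem_range_self f e)
    hjm he

end RankOne

end Literature.NumberTheory.EllipticCurves.IwasawaAlgebra

end
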